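/-
Copyright (c) 2026 the pub-hodgecm-mathlib formalisation cell (harness21).  Prover seat hodgecm-mathlib-K2E1-p12 (g3), Track B ∕ K2-LIT, h413 = `stmt-HodgeConjecture-24833`,
route of record `HCCMUnconditional`, ROADCARD «5Res ENDGAME BY FAMILIES» AMENDMENT #4 (R3∕G10∕G11 currency bridge): THE `K′`-TYPE CHARACTER OF THE ADELIC LEVEL `Kad = ι_∞κ(K)·ι_f(K′_f)`
— from a character `τ` of the compact archimedean group `K` one builds `ω : ↥Kad →* ℂ` with `ω(ι_∞κ k) = τ k`, `ω(ι_f u) = 1` (`ω = τ ∘ κ⁻¹ ∘ archPart`), unitary and continuous when `τ` is,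
and the `(Kad, ω)`-isotypic subspace of ANY representation is the `K′_f`-invariants ⊓ the `(K, τ)`-isotypic part — the bridge between ★ C7 HEAD″ ∕ G10 `hEisdef_of_kType` (subgroup +
character currency) and the G11 τ-skeleton (product currency).
-/
import Literature.NumberTheory.Automorphic.UnitaryGroupAdelicProduct      -- ★ `archPart`, `finPart`, `archToAdelic_mul_finAdelicToAdelic`, `continuous_archPart`
import Mathlib.LinearAlgebra.Eigenspace.Basic
import Mathlib.Topology.Algebra.Module.Basic
import HarnessLib

/-!
# h413 ∕ Track B «K2-LIT», AMENDMENT #4 — helper `K2E1KTypeCharacterArchLevelU`: THE CHARACTER `ω = τ ∘ κ⁻¹ ∘ (·)_∞` OF THE ADELIC LEVEL `Kad = ⟨ι_∞κ(K) ∪ ι_f(K′_f)⟩ ≤ U(J)(𝔸_F)` AND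
# THE IDENTITY `L^{(Kad, ω)} = L^{K′_f} ⊓ L^{(K, τ)}` OF ISOTYPIC SUBSPACES (every rank `N`, every form `J`, every representation)

Cell `pub/hodgecm-mathlib`, crux h413 = `stmt-HodgeConjecture-24833`, route of record `HCCMUnconditional`; dealer K2E1-plan (g7) (AMENDMENT #4: R3 «typed τ-generally», G10, G11 τ-skeleton
of K2E4-p11); offer (a) of this seat 2026-09-04T14:38Z.  THEOREMS ONLY (no `def`, no `instance`, no notation, no named-fact hypothesis, no `sorry`); lane `--supports stmt-HodgeConjecture-24833
--as helper` (count-neutral).  Closes no socket.  Generic quadratic datum `(F, E, c)`, rank `N`, form `J`; `κ : K →* U(J)(E ⊗ ℝ)` an INJECTIVE homomorphism from a group `K` (the maximal compact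
`K_∞`, e.g. K2E2-p12's `Subgroup.inclusion inf_le_left`), `K′_f ≤ U(J)(𝔸_{F,f})` any subgroup, `τ : K →* ℂ` any character.

THE MATHEMATICS ([BorelJacquet1979, §4.1]; [Knapp1986, VIII §3]).  `U(J)(𝔸_F) = U(J)(E ⊗ ℝ) × U(J)(𝔸_{F,f})` with commuting factors and continuous projections `g ↦ g_∞`, `g ↦ g_f` (★
`UnitaryGroupAdelicProduct`).  The level `Kad := closure(ι_∞κ(K) ∪ ι_f(K′_f))` satisfies `(Kad)_∞ ⊆ κ(K)`, `(Kad)_f ⊆ K′_f` (§1: the set of such `g` is a subgroup containing the generators), so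
`ω := τ ∘ κ⁻¹ ∘ (·)_∞` is a well-defined homomorphism `↥Kad →* ℂ` (Mathlib `MonoidHom.ofInjective`, `MonoidHom.codRestrict`) with `ω(ι_∞κk) = τ(k)`, `ω(ι_f u) = τ(1) = 1`; `‖ω‖ = 1` if `‖τ‖ = 1`;
and `ω` is continuous if `τ` and `κ` are, `K` compact (then `κ` is a closed embedding, Mathlib `Continuous.isClosedEmbedding`, so `κ⁻¹ ∘ (·)_∞` is continuous).  Since every `x ∈ Kad` is
`ι_∞κ(k)·ι_f(u)` with `κ k = x_∞`, `u = x_f ∈ K′_f`, a vector `v` of a representation `π` satisfies `π(x) v = ω(x) v ∀ x ∈ Kad` iff `π(ι_f u) v = v ∀ u ∈ K′_f` and `π(ι_∞κ k) v = τ(k) v ∀ k`.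
* §1 `closure_le_comap_range_inf_comap` (`Kad ≤ κ(K)_∞-preimage ⊓ K′_f-preimage`), `archPart_mem_range`, `finPart_mem`.
* §2 **`exists_kTypeCharacter`** — `∃ ω : ↥Kad →* ℂ` with the generator values, the formula clause `∀ x, ∃ k, κ k = x_∞ ∧ x_f ∈ K′_f ∧ ω x = τ k`, unitarity and continuity transfer.
* §3 **`forall_apply_eq_smul_iff`** — for ANY such `ω` (generator values) and any monoid action `π : G →* (V →ₗ V)`: `(∀ x : ↥Kad, π x v = ω x • v) ↔ (∀ u ∈ K′_f, π (ι_f u) v = v) ∧ ∀ k, π (ι_∞κk) v = τ k • v`.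
FED-BY: `K := U(J)(E ⊗ ℝ)`, `κ := id` (injective), `τ := 1`, `K′_f := ⊤` instantiate every hypothesis of §2 (§4 `kTypeCharacter_witness`); the intended datum is K2E2-p12's
`κ := Subgroup.inclusion (inf_le_left : arch ⊓ U(1⊗1) ≤ arch)` (injective: `Subgroup.inclusion_injective`).
HONEST LABEL: HC_CM is proved only modulo the 7 printed citations (2 remaining named inputs: hLiu418 = `stmt-HodgeConjecture-24832`, h413 = `stmt-HodgeConjecture-24833`) until rung 0
closes; this file asserts no named fact and closes no socket.
References: [BorelJacquet1979] A. Borel, H. Jacquet, *Automorphic forms and automorphic representations*, §4.1; [Knapp1986] A. W. Knapp, *Representation Theory of Semisimple Groups*, VIII §3.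
-/

set_option autoImplicit false
set_option linter.dupNamespace false  -- the mandated namespace repeats the summit's segment (`HodgeConjecture.HodgeConjecture`)

noncomputable section

open Set Filter Topology NumberField IsDedekindDomain
open Literature.NumberTheory.Automorphic Literature.NumberTheory.Automorphic.UnitaryGroup

namespace Summit.HodgeConjecture.HodgeConjecture.Cruxes.H413.K2E1KTypeCharacterArchLevelU

variable {F E : Type} [Field F] [NumberField F] [Field E] [NumberField E] [Algebra F E] {c : E ≃ₐ[F] E} {N : ℕ} {J : Matrix (Fin N) (Fin N) E}
  {K : Type*} [Group K] (κ : K →* arch F E c N J) (Kf : Subgroup (finAdelic F E c N J))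

/-! ## §1 The archimedean and finite components of the level `Kad` -/

/-- **`Kad ≤ (κ(K))_∞-preimage ⊓ (K′_f)_f-preimage`**: every `x ∈ closure(ι_∞κ(K) ∪ ι_f(K′_f))` has `x_∞ ∈ κ(K)` and `x_f ∈ K′_f` (the right side is a subgroup containing the generators:
`(ι_∞κk)_∞ = κk`, `(ι_∞κk)_f = 1`, `(ι_f u)_∞ = 1`, `(ι_f u)_f = u`). [cite: BorelJacquet1979, §4.1] -/
theorem closure_le_comap_range_inf_comap :
    (Subgroup.closure ((Set.range (fun k : K => (archToAdelic F E c N J) (κ k)) ∪ (finAdelicToAdelic F E c N J) '' (Kf : Set (finAdelic F E c N J))) : Set (adelicGroupData F E c N J).Adelic)) ≤ (κ.range.comap (archPart F E c N J)) ⊓ (Kf.comap (finPart F E c N J)) := by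
  refine (Subgroup.closure_le _).2 ?_
  rintro g (⟨k, rfl⟩ | ⟨u, hu, rfl⟩)
  · refine ⟨Subgroup.mem_comap.2 ?_, Subgroup.mem_comap.2 ?_⟩
    · rw [archPart_archToAdelic]; exact ⟨k, rfl⟩
    · rw [finPart_archToAdelic]; exact Kf.one_mem
  · refine ⟨Subgroup.mem_comap.2 ?_, Subgroup.mem_comap.2 ?_⟩
    · rw [archPart_finAdelicToAdelic]; exact κ.range.one_mem
    · rw [finPart_finAdelicToAdelic]; exact hu

/-- `x ∈ Kad ⇒ x_∞ ∈ κ(K)`. [cite: BorelJacquet1979, §4.1] -/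
theorem archPart_mem_range (x : ↥(Subgroup.closure ((Set.range (fun k : K => (archToAdelic F E c N J) (κ k)) ∪ (finAdelicToAdelic F E c N J) '' (Kf : Set (finAdelic F E c N J))) : Set (adelicGroupData F E c N J).Adelic))) : archPart F E c N J (x : (adelicGroupData F E c N J).Adelic) ∈ κ.range :=
  Subgroup.mem_comap.1 (closure_le_comap_range_inf_comap κ Kf x.2).1

/-- `x ∈ Kad ⇒ x_f ∈ K′_f`. [cite: BorelJacquet1979, §4.1] -/
theorem finPart_mem (x : ↥(Subgroup.closure ((Set.range (fun k : K => (archToAdelic F E c N J) (κ k)) ∪ (finAdelicToAdelic F E c N J) '' (Kf : Set (finAdelic F E c N J))) : Set (adelicGroupData F E c N J).Adelic))) : finPart F E c N J (x : (adelicGroupData F E c N J).Adelic) ∈ Kf :=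
  Subgroup.mem_comap.1 (closure_le_comap_range_inf_comap κ Kf x.2).2

/-! ## §2 The character `ω = τ ∘ κ⁻¹ ∘ (·)_∞` of `Kad` -/

/-- **THE `K′`-TYPE CHARACTER OF THE ADELIC LEVEL**: for an injective `κ : K →* U(J)(E ⊗ ℝ)`, a subgroup `K′_f ≤ U(J)(𝔸_{F,f})` and a character `τ : K →* ℂ`, there is `ω : ↥Kad →* ℂ` on
`Kad = closure(ι_∞κ(K) ∪ ι_f(K′_f))` with: (i) `ω(ι_∞κ k) = τ k`; (ii) `ω(ι_f u) = 1` for `u ∈ K′_f`; (iii) the FORMULA `∀ x, ∃ k, κ k = x_∞ ∧ x_f ∈ K′_f ∧ ω x = τ k`; (iv) `‖τ‖ = 1 ⇒ ‖ω‖ = 1`;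
(v) `K` compact, `κ` and `τ` continuous ⇒ `ω` continuous (`κ` is then a closed embedding).  This is the `ω` of ★ G10 `hEisdef_of_kType` (with `τ k := χ(k⁻¹)`) and of ★ C7 HEAD″ at `K′ = Kad`.
[cite: BorelJacquet1979, §4.1] [cite: Knapp1986, VIII §3] -/
theorem exists_kTypeCharacter [TopologicalSpace K] (hκ : Function.Injective κ) (τ : K →* ℂ) :
    ∃ ω : ↥(Subgroup.closure ((Set.range (fun k : K => (archToAdelic F E c N J) (κ k)) ∪ (finAdelicToAdelic F E c N J) '' (Kf : Set (finAdelic F E c N J))) : Set (adelicGroupData F E c N J).Adelic)) →* ℂ,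
      (∀ k : K, ω ⟨(archToAdelic F E c N J) (κ k), Subgroup.subset_closure (Or.inl ⟨k, rfl⟩)⟩ = τ k) ∧
      (∀ (u : finAdelic F E c N J) (hu : u ∈ Kf), ω ⟨(finAdelicToAdelic F E c N J) u, Subgroup.subset_closure (Or.inr ⟨u, hu, rfl⟩)⟩ = 1) ∧
      (∀ x : ↥(Subgroup.closure ((Set.range (fun k : K => (archToAdelic F E c N J) (κ k)) ∪ (finAdelicToAdelic F E c N J) '' (Kf : Set (finAdelic F E c N J))) : Set (adelicGroupData F E c N J).Adelic)), ∃ k : K, κ k = archPart F E c N J (x : (adelicGroupData F E c N J).Adelic) ∧ finPart F E c N J (x : (adelicGroupData F E c N J).Adelic) ∈ Kf ∧ ω x = τ k) ∧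
      ((∀ k, ‖τ k‖ = 1) → ∀ x, ‖ω x‖ = 1) ∧
      (CompactSpace K → IsTopologicalGroup K → Continuous κ → Continuous τ → Continuous ω) := by
  -- `ρ : Kad →* κ(K)`, `x ↦ x_∞`; `e : κ(K) ≃* K`; `ω := τ ∘ e ∘ ρ`
  set ρ : ↥(Subgroup.closure ((Set.range (fun k : K => (archToAdelic F E c N J) (κ k)) ∪ (finAdelicToAdelic F E c N J) '' (Kf : Set (finAdelic F E c N J))) : Set (adelicGroupData F E c N J).Adelic)) →* ↥κ.range := ((archPart F E c N J).comp (Subgroup.subtype _)).codRestrict κ.range (archPart_mem_range κ Kf) with hρ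
  set e : ↥κ.range ≃* K := (MonoidHom.ofInjective hκ).symm with he
  have heκ : ∀ k : K, e ⟨κ k, ⟨k, rfl⟩⟩ = k := fun k => by
    rw [he, MulEquiv.symm_apply_eq]; exact Subtype.ext rfl
  have hκe : ∀ y : ↥κ.range, κ (e y) = (y : arch F E c N J) := fun y => by rw [he]; exact MonoidHom.apply_ofInjective_symm hκ y
  refine ⟨τ.comp (e.toMonoidHom.comp ρ), fun k => ?_, fun u hu => ?_, fun x => ?_, fun hτ x => ?_, fun hKc hKg hκc hτc => ?_⟩
  · show τ (e (ρ ⟨(archToAdelic F E c N J) (κ k), _⟩)) = τ k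
    have h1 : ρ ⟨(archToAdelic F E c N J) (κ k), Subgroup.subset_closure (Or.inl ⟨k, rfl⟩)⟩ = ⟨κ k, ⟨k, rfl⟩⟩ := Subtype.ext (archPart_archToAdelic F E c N J (κ k))
    rw [h1, heκ]
  · show τ (e (ρ ⟨(finAdelicToAdelic F E c N J) u, _⟩)) = 1
    have h1 : ρ ⟨(finAdelicToAdelic F E c N J) u, Subgroup.subset_closure (Or.inr ⟨u, hu, rfl⟩)⟩ = 1 := Subtype.ext (archPart_finAdelicToAdelic F E c N J u)
    rw [h1, map_one, map_one]
  · refine ⟨e (ρ x), ?_, finPart_mem κ Kf x, rfl⟩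
    rw [hκe]; rfl
  · show ‖τ (e (ρ x))‖ = 1
    exact hτ _
  · haveI := hKc; haveI := hKg
    have hemb : Topology.IsClosedEmbedding κ := hκc.isClosedEmbedding hκ
    have hρc : Continuous ρ := ((continuous_archPart F E c N J).comp continuous_subtype_val).subtype_mk _
    have heρ : Continuous (fun x => e (ρ x)) := by
      rw [hemb.isEmbedding.isInducing.continuous_iff]
      have : (κ ∘ fun x => e (ρ x)) = fun x => ((ρ x : ↥κ.range) : arch F E c N J) := funext fun x => hκe (ρ x)
      rw [this]; exact continuous_subtype_val.comp hρc
    exact hτc.comp heρ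

/-! ## §3 The `(Kad, ω)`-isotypic vectors are the `K′_f`-invariant `(K, τ)`-isotypic vectors -/

/-- **`L^{(Kad, ω)} = L^{K′_f} ∩ L^{(K, τ)}`** for every monoid action `π : U(J)(𝔸_F) →* End(V)` and every `ω : ↥Kad →* ℂ` with the generator values `ω(ι_∞κk) = τ k`, `ω(ι_f u) = 1`:
`(∀ x ∈ Kad, π x v = ω x • v) ↔ (∀ u ∈ K′_f, π (ι_f u) v = v) ∧ (∀ k, π (ι_∞κ k) v = τ k • v)` (⇒: generators; ⇐: closure induction, `ω` multiplicative). [cite: Knapp1986, VIII §3] -/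
theorem forall_apply_eq_smul_iff {V : Type*} [AddCommGroup V] [Module ℂ V] (π : (adelicGroupData F E c N J).Adelic →* V →ₗ[ℂ] V) (τ : K →* ℂ)
    (ω : ↥(Subgroup.closure ((Set.range (fun k : K => (archToAdelic F E c N J) (κ k)) ∪ (finAdelicToAdelic F E c N J) '' (Kf : Set (finAdelic F E c N J))) : Set (adelicGroupData F E c N J).Adelic)) →* ℂ)
    (hωarch : ∀ k : K, ω ⟨(archToAdelic F E c N J) (κ k), Subgroup.subset_closure (Or.inl ⟨k, rfl⟩)⟩ = τ k)
    (hωfin : ∀ (u : finAdelic F E c N J) (hu : u ∈ Kf), ω ⟨(finAdelicToAdelic F E c N J) u, Subgroup.subset_closure (Or.inr ⟨u, hu, rfl⟩)⟩ = 1) (v : V) :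
    (∀ x : ↥(Subgroup.closure ((Set.range (fun k : K => (archToAdelic F E c N J) (κ k)) ∪ (finAdelicToAdelic F E c N J) '' (Kf : Set (finAdelic F E c N J))) : Set (adelicGroupData F E c N J).Adelic)), π (x : (adelicGroupData F E c N J).Adelic) v = ω x • v) ↔
      (∀ u ∈ Kf, π ((finAdelicToAdelic F E c N J) u) v = v) ∧ (∀ k : K, π ((archToAdelic F E c N J) (κ k)) v = τ k • v) := by
  refine ⟨fun h => ⟨fun u hu => ?_, fun k => ?_⟩, fun h => ?_⟩
  · have h1 := h ⟨(finAdelicToAdelic F E c N J) u, Subgroup.subset_closure (Or.inr ⟨u, hu, rfl⟩)⟩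
    rwa [hωfin u hu, one_smul] at h1
  · have h1 := h ⟨(archToAdelic F E c N J) (κ k), Subgroup.subset_closure (Or.inl ⟨k, rfl⟩)⟩
    rwa [hωarch k] at h1
  · rintro ⟨g, hg⟩
    induction hg using Subgroup.closure_induction with
    | mem g hg' =>
        rcases hg' with ⟨k, rfl⟩ | ⟨u, hu, rfl⟩
        · rw [h.2 k, hωarch k]
        · rw [h.1 u hu, hωfin u hu, one_smul]
    | one => rw [map_one, Module.End.one_apply, show (⟨1, Subgroup.one_mem _⟩ : ↥(Subgroup.closure ((Set.range (fun k : K => (archToAdelic F E c N J) (κ k)) ∪ (finAdelicToAdelic F E c N J) '' (Kf : Set (finAdelic F E c N J))) : Set (adelicGroupData F E c N J).Adelic))) = 1 from rfl, map_one, one_smul]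
    | mul a b ha hb iha ihb =>
        rw [map_mul, Module.End.mul_apply, ihb, map_smul, iha, smul_smul,
          show (⟨a * b, Subgroup.mul_mem _ ha hb⟩ : ↥(Subgroup.closure ((Set.range (fun k : K => (archToAdelic F E c N J) (κ k)) ∪ (finAdelicToAdelic F E c N J) '' (Kf : Set (finAdelic F E c N J))) : Set (adelicGroupData F E c N J).Adelic))) = ⟨a, ha⟩ * ⟨b, hb⟩ from rfl, map_mul, mul_comm]
    | inv a ha ih =>
        have hωa : ω ⟨a, ha⟩ ≠ 0 := by
          intro h0
          have h1 : ω (⟨a, ha⟩⁻¹ * ⟨a, ha⟩) = 1 := by rw [inv_mul_cancel, map_one]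
          rw [map_mul, h0, mul_zero] at h1
          exact zero_ne_one h1
        have h2 : π a⁻¹ (π a v) = v := by rw [← Module.End.mul_apply, ← map_mul, inv_mul_cancel, map_one, Module.End.one_apply]
        rw [ih, map_smul] at h2
        calc π a⁻¹ v = (ω ⟨a, ha⟩)⁻¹ • (ω ⟨a, ha⟩ • π a⁻¹ v) := by rw [smul_smul, inv_mul_cancel₀ hωa, one_smul]
          _ = (ω ⟨a, ha⟩)⁻¹ • v := by rw [h2]
          _ = ω ⟨a⁻¹, Subgroup.inv_mem _ ha⟩ • v := by rw [show (⟨a⁻¹, Subgroup.inv_mem _ ha⟩ : ↥(Subgroup.closure ((Set.range (fun k : K => (archToAdelic F E c N J) (κ k)) ∪ (finAdelicToAdelic F E c N J) '' (Kf : Set (finAdelic F E c N J))) : Set (adelicGroupData F E c N J).Adelic))) = ⟨a, ha⟩⁻¹ from rfl, map_inv]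

/-! ## §4 FED-BY witness: the hypotheses of §2 are jointly satisfiable (`K := U(J)(E ⊗ ℝ)` itself, `κ := id`, `τ := 1`, `K′_f := ⊤`) -/

/-- **NON-VACUITY WITNESS (chair R39 «fed-by»)**: §2 instantiated at `κ := id` on `K := U(J)(E ⊗ ℝ)` (injective), `τ := 1`, `K′_f := ⊤` — an `ω` with the generator values exists and is
unitary (here `ω = 1`). [folklore] -/
theorem kTypeCharacter_witness :
    ∃ ω : ↥(Subgroup.closure ((Set.range (fun k : ↥(arch F E c N J) => (archToAdelic F E c N J) ((MonoidHom.id ↥(arch F E c N J)) k)) ∪ (finAdelicToAdelic F E c N J) '' ((⊤ : Subgroup (finAdelic F E c N J)) : Set (finAdelic F E c N J))) : Set (adelicGroupData F E c N J).Adelic)) →* ℂ,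
      (∀ k : ↥(arch F E c N J), ω ⟨(archToAdelic F E c N J) ((MonoidHom.id ↥(arch F E c N J)) k), Subgroup.subset_closure (Or.inl ⟨k, rfl⟩)⟩ = (1 : ↥(arch F E c N J) →* ℂ) k) ∧
      ∀ x, ‖ω x‖ = 1 := by
  obtain ⟨ω, h1, -, -, h4, -⟩ := exists_kTypeCharacter (MonoidHom.id ↥(arch F E c N J)) (⊤ : Subgroup (finAdelic F E c N J)) (fun _ _ h => h) (1 : ↥(arch F E c N J) →* ℂ)
  exact ⟨ω, h1, h4 fun k => by rw [MonoidHom.one_apply, norm_one]⟩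

end Summit.HodgeConjecture.HodgeConjecture.Cruxes.H413.K2E1KTypeCharacterArchLevelU

end
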